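import Literature.AlgebraicGeometry.Motives.HodgeThetaSubalgebraUnitaryOrthogonalChainPos
import Literature.AlgebraicGeometry.Motives.HodgeThetaSubalgebraUnitaryFortyOneFortyThreeGoodRankCores
import Literature.AlgebraicGeometry.Motives.HodgeThetaSubalgebraUnitaryRaisingDimension
import Literature.AlgebraicGeometry.Motives.HodgeThetaSubalgebraUnitaryThirtyTwoFiftyOneCorePart1
import Literature.AlgebraicGeometry.Motives.HodgeThetaSubalgebraUnitaryTwentyEightFiftyFiveCorePart1
import Literature.AlgebraicGeometry.Motives.HodgeThetaSubalgebraUnitaryTwentyEightThirtyNineCorePart2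
import Literature.AlgebraicGeometry.Motives.HodgeThetaSubalgebraUnitaryTwentyEightThirtyThreeCorePart1
import Literature.AlgebraicGeometry.Motives.HodgeThetaSubalgebraUnitaryTwentyOneFiftyCorePart1
import Literature.AlgebraicGeometry.Motives.HodgeThetaSubalgebraUnitaryTwentyEightFiftyOneCorePart2
import HarnessLib
import Literature.AlgebraicGeometry.Motives.HodgeThetaSubalgebraUnitaryConstantRankLeviThree
import Literature.AlgebraicGeometry.Motives.HodgeThetaSubalgebraUnitaryEightNineCore
import Literature.AlgebraicGeometry.Motives.HodgeThetaSubalgebraUnitaryFiveCoreAll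
import Literature.AlgebraicGeometry.Motives.HodgeThetaSubalgebraUnitaryFourOddCore
import Literature.AlgebraicGeometry.Motives.HodgeThetaSubalgebraUnitarySixSevenCoreAll
import Literature.AlgebraicGeometry.Motives.HodgeThetaSubalgebraUnitaryThreeCoprimeCore

/-!
# (Part 3 of 3 — lemmas) The `Θ`-subalgebra theorem for unitary multiplicities `(28, 51)` — a `p = 79` cell by minimal-rank base points
# and sub-Levi recursion (Ribet 1983 Thm. 3, Lie step; abelian 79-folds of type `(28, 51)`)

Family `hodge`, layer `Literature/AlgebraicGeometry/Motives` (pure linear algebra over `ℂ`; no geometry). Research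
context: cell `pub-hodge-ring2` (HONEST FRAMING: research route conditional on HC_CM; not a corollary; Q11.4-sentence-2
already refuted in dim ≥ 3), Literature lane gen 89. UNCONDITIONAL; theorems only, no definition, no named fact
(D-0026), no `sorry`.

THE PRINT. K. A. Ribet, Amer. J. Math. 105 (1983), Thm. 3 = Gordon's survey Thm. 6.3 (3) [held
`paper:arxiv-alg-geom_9709030` p. 18]. THE METHOD: `HodgeThetaSubalgebraUnitarySixteenTwentyOneCore` (a raising operator
`B` of MINIMAL non-zero rank `m`, the profile dichotomy `i + j ≤ m` or `i, j ≥ m`, tree cores making a Levi algebra full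
or killing a Levi rank, lifts `UnitaryRaisingSpace.exists_raise_finrank_range_eq` + `UnitaryLeviSetup.exists_lift`, two
pencils `UnitaryGenericRank.exists_finrank_le_and_finrank_le`, the non-vanishing lemma
`UnitaryLeviFull.exists_raise_commute_apply_ne_zero`, TOOL C `UnitaryConstantRank.exists_raise_rank_ne_two`, TOOL F
`UnitaryConstantRank.false_of_le_rank`), the full-rank chain `UnitaryConstantRank.dvd_of_rank_eq_finrank`
(`HodgeThetaSubalgebraUnitaryNineTwentyEightCore`) and TOOL G `UnitaryOrthogonalChain.false_of_constProfile`.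

THIS PART FILE holds minimal-rank lemmas of the cell (the gate caps a proposal at 200 kB); the core theorem `UnitaryTwentyEightFiftyOne.eq_top_of_smul` is assembled in `HodgeThetaSubalgebraUnitaryTwentyEightFiftyOneCore`.

THE CELL `(28 | 51)`. Good ranks 1, 2, 4, 5, 7, 11, 13 (Levi types `(1|50)`, `(2|49)`, `(4|47)`, `(5|46)`, `(7|44)`, `(11|40)`, `(13|38)` are tree cores); a proper `𝔊` has
raising ranks in `{0, 3, 6, 8, 9, 10, 12, 14, 15, 16, 17, 18, 19, 20, 21, 22, 23, 24, 25, 26, 27, 28}`; `m` minimal non-zero, `B` of rank `m`; a commuting raising `X` has profile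
`(i, j)` (`i + j` a raising rank, `i + j ≤ m` or `i, j ≥ m`). SUB-LEVI RECURSION: when the non-zero profiles are constantly
`(i, j)`, the Levi algebra `L⁺` (resp. `L⁻`) is a `Θ`-algebra whose non-zero raising ranks are all `i` (resp. `j`), and the
same minimal-rank analysis applies to it (the `sub…` lemmas of §1).
* `m = 3` (`U⁺` of type `(25 | 3)`, `U⁻` of type `(3 | 48)`): `L⁺` of type `(25 | 3)` is full and a lift with `i = 2` has `j ∈ {1}`, killed in `L⁻` (type `(3 | 48)`).
* `m = 6` (`U⁺` of type `(22 | 6)`, `U⁻` of type `(6 | 45)`): after the Levi kills the profiles are [(0, 0), (0, 6), (6, 0), (6, 6)], so `L⁺` (type `(22 | 6)`) is a `Θ`-algebra with non-zero raising ranks in `{6}` — impossible by the sub-Levi lemmas.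
* `m = 8` (`U⁺` of type `(20 | 8)`, `U⁻` of type `(8 | 43)`): after the Levi kills every profile has `j = 0` (profiles [(0, 0), (8, 0)]), against the non-vanishing lemma on `U⁻`.
* `m = 9` (`U⁺` of type `(19 | 9)`, `U⁻` of type `(9 | 42)`): after the Levi kills every profile has `i = 0` (profiles [(0, 0), (0, 9)]), against the non-vanishing lemma.
* `m = 10` (`U⁺` of type `(18 | 10)`, `U⁻` of type `(10 | 41)`): after the Levi kills every profile has `i = 0` (profiles [(0, 0)]), against the non-vanishing lemma.
* `m = 12` (`U⁺` of type `(16 | 12)`, `U⁻` of type `(12 | 39)`): after the Levi kills the profiles are [(0, 0), (0, 12), (2, 10), (4, 8), (6, 6), (12, 0), (12, 12)], so `L⁻` (type `(12 | 39)`) is a `Θ`-algebra with non-zero raising ranks in `{6, 8, 10, 12}` — impossible by the sub-Levi lemmas.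
* `m = 14` (`U⁺` of type `(14 | 14)`, `U⁻` of type `(14 | 37)`): after the Levi kills every profile has `j = 0` (profiles [(0, 0), (14, 0)]), against the non-vanishing lemma on `U⁻`.
* `m = 15` (`U⁺` of type `(13 | 15)`, `U⁻` of type `(15 | 36)`): `L⁺` of type `(13 | 15)` is full and a lift with `i = 2` has `j ∈ {13}`, killed in `L⁻` (type `(15 | 36)`).
* `m = 16` (`U⁺` of type `(12 | 16)`, `U⁻` of type `(16 | 35)`): the non-zero profiles [(0, 16), (2, 14), (4, 12), (6, 10), (8, 8)] are pairwise exclusive, so constant; `(2, 14)`: TOOL C on `L⁺`; `(4, 12)`: `L⁺` (type `(12 | 16)`) has constant rank `4`; `(6, 10)`: `L⁺` (type `(12 | 16)`) has constant rank `6`; `(8, 8)`: `L⁺` (type `(12 | 16)`) has constant rank `8`.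
* `m = 17` (`U⁺` of type `(11 | 17)`, `U⁻` of type `(17 | 34)`): `L⁺` of type `(11 | 17)` is full and a lift with `i = 4` has `j ∈ {13}`, killed in `L⁻` (type `(17 | 34)`).
* `m = 18` (`U⁺` of type `(10 | 18)`, `U⁻` of type `(18 | 33)`): the non-zero profiles [(0, 18), (3, 15), (4, 14), (6, 12), (9, 9), (10, 8)] are pairwise exclusive, so constant; `(3, 15)`: `L⁺` (type `(10 | 18)`) has constant rank `3`; `(4, 14)`: `L⁺` (type `(10 | 18)`) has constant rank `4`; `(6, 12)`: `L⁺` (type `(10 | 18)`) has constant rank `6`; `(9, 9)`: TOOL G; `(10, 8)`: TOOL G.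
* `m = 19` (`U⁺` of type `(9 | 19)`, `U⁻` of type `(19 | 32)`): after the Levi kills every profile has `i = 0` (profiles [(0, 0)]), against the non-vanishing lemma.
* `m = 20` (`U⁺` of type `(8 | 20)`, `U⁻` of type `(20 | 31)`): after the Levi kills every profile has `i = 0` (profiles [(0, 0)]), against the non-vanishing lemma.
* `m = 21` (`U⁺` of type `(7 | 21)`, `U⁻` of type `(21 | 30)`): the non-zero profiles [(0, 21), (3, 18), (6, 15), (7, 14)] are pairwise exclusive, so constant; `(3, 18)`: `L⁺` (type `(7 | 21)`) has constant rank `3`; `(6, 15)`: `L⁻` (type `(21 | 30)`) has constant rank `15`; `(7, 14)`: TOOL G.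
* `m = 22` (`U⁺` of type `(6 | 22)`, `U⁻` of type `(22 | 29)`): after the Levi kills every profile has `i = 0` (profiles [(0, 0)]), against the non-vanishing lemma.
* `m = 23` (`U⁺` of type `(5 | 23)`, `U⁻` of type `(23 | 28)`): `L⁺` of type `(5 | 23)` is full; two pencils (lifts with `i = 1`, `i = 2`).
* `m = 24` (`U⁺` of type `(4 | 24)`, `U⁻` of type `(24 | 27)`): after the Levi kills every profile has `i = 0` (profiles [(0, 0), (0, 24)]), against the non-vanishing lemma.
* `m = 25` (`U⁺` of type `(3 | 25)`, `U⁻` of type `(25 | 26)`): `L⁺` of type `(3 | 25)` is full and a lift with `i = 2` has `j ∈ {23}`, killed in `L⁻` (type `(25 | 26)`).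
* `m = 26` (`U⁺` of type `(2 | 26)`, `U⁻` of type `(26 | 25)`): after the Levi kills every profile has `i = 0` (profiles [(0, 0)]), against the non-vanishing lemma.
* `m = 27` (`U⁺` of type `(1 | 27)`, `U⁻` of type `(27 | 24)`): `L⁺` of type `(1 | 27)` is full and a lift with `i = 1` has no feasible `j`.
* `m = 28 = dim P`: the full-rank chain would give `28 ∣ 51`.

## References
* [Ribet1983] K. A. Ribet, *Hodge classes on certain types of abelian varieties*, Amer. J. Math. 105 (1983), Thm. 3.
* [Gordon1997] B. B. Gordon, *A survey of the Hodge conjecture for abelian varieties*, Thm. 6.3 (3), pp. 18–19.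
* [Deligne1982HodgeCycles] P. Deligne, *Hodge cycles on abelian varieties*, LNM 900 (1982), I §3 Prop. 3.4, 3.6.
* [GoodmanWallachGTM255] R. Goodman, N. R. Wallach, GTM 255 (2009), §2.3.1, §4.1.1.
* [HoffmanKunze1971LinearAlgebra] K. Hoffman, R. Kunze, *Linear Algebra* (1971), §3.1 Thm. 2, §6.7, §8.5.
-/

noncomputable section

open Module

namespace Literature.AlgebraicGeometry.Motives

namespace HodgeStructure

universe u

variable {W : Type u} [AddCommGroup W] [Module ℂ W]

/-! ### §2 The minimal-rank lemmas -/

/-- `(28 | 51)`, minimal rank `23`: `L⁺` of type `(5 | 23)` is full; two pencils (lifts with `i = 1`, `i = 2`). [cite: Ribet1983, Thm. 3] [cite: Gordon1997, Thm. 6.3 (3)]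
[cite: Deligne1982HodgeCycles, I §3 Prop. 3.4, 3.6] [cite: GoodmanWallachGTM255, §4.1.1] -/
theorem UnitaryTwentyEightFiftyOne.no_minRank_23 [FiniteDimensional ℂ W] {𝔊 : Submodule ℂ (Module.End ℂ W)}
    (hbr : ∀ Y ∈ 𝔊, ∀ Z ∈ 𝔊, Y * Z - Z * Y ∈ 𝔊)
    (hirr : ∀ U : Submodule ℂ W, (∀ A ∈ 𝔊, ∀ u ∈ U, A u ∈ U) → U = ⊥ ∨ U = ⊤)
    {Θ : Module.End ℂ W} (hΘ : Θ ∈ 𝔊) (hΘΘ : Θ * Θ = 1)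
    {P Q : Submodule ℂ W} (hP : ∀ x, x ∈ P ↔ Θ x = x) (hQ : ∀ x, x ∈ Q ↔ Θ x = -x)
    (hP28 : Module.finrank ℂ P = 28) (hQ51 : Module.finrank ℂ Q = 51)
    {s : W → W → ℂ} (hadd : ∀ x y z, s (x + y) z = s x z + s y z)
    (hsmul : ∀ (c : ℂ) (x y : W), s (c • x) y = c * s x y) (hsymm : ∀ x y, s y x = starRingEnd ℂ (s x y))
    (hPQ : ∀ p ∈ P, ∀ q ∈ Q, s p q = 0) (hdefP : ∀ p ∈ P, s p p = 0 → p = 0) (hdefQ : ∀ q ∈ Q, s q q = 0 → q = 0)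
    (hadj : ∀ X ∈ 𝔊, ∃ Y ∈ 𝔊, ∀ x y, s (X x) y = s x (Y y))
    (hS : ∀ B' ∈ 𝔊, Θ * B' = B' → B' * Θ = -B' →
      Module.finrank ℂ (LinearMap.range B') = 0 ∨ Module.finrank ℂ (LinearMap.range B') = 23 ∨ Module.finrank ℂ (LinearMap.range B') = 24 ∨ Module.finrank ℂ (LinearMap.range B') = 25 ∨ Module.finrank ℂ (LinearMap.range B') = 26 ∨ Module.finrank ℂ (LinearMap.range B') = 27 ∨ Module.finrank ℂ (LinearMap.range B') = 28)
    {B : Module.End ℂ W} (hB : B ∈ 𝔊) (hΘB : Θ * B = B) (hBΘ : B * Θ = -B)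
    (hr : Module.finrank ℂ (LinearMap.range B) = 23) : False := by
  classical
  have hsU : ∀ U : Submodule ℂ W, ∀ x y z : U, s ((x + y : U) : W) z = s (x : W) z + s (y : W) z :=
    fun U x y z => by simp only [Submodule.coe_add, hadd]
  have hsmU : ∀ U : Submodule ℂ W, ∀ (c : ℂ) (x y : U), s ((c • x : U) : W) y = c * s (x : W) y :=
    fun U c x y => by simp only [Submodule.coe_smul, hsmul]
  have hno1 : ∀ B' ∈ 𝔊, Θ * B' = B' → B' * Θ = -B' → Module.finrank ℂ (LinearMap.range B') ≠ 1 := by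
    intro B' hB' hΘB' hB'Θ h1
    rcases hS B' hB' hΘB' hB'Θ with h | h | h | h | h | h | h <;> omega
  have hmin : ∀ Y ∈ 𝔊, Θ * Y = Y → Y * Θ = -Y → Y ≠ 0 → 23 ≤ Module.finrank ℂ (LinearMap.range Y) := by
    intro Y hY hΘY hYΘ hY0
    have h0 : Module.finrank ℂ (LinearMap.range Y) ≠ 0 := fun h =>
      hY0 (LinearMap.range_eq_bot.1 (Submodule.finrank_eq_zero.1 h))
    rcases hS Y hY hΘY hYΘ with h | h | h | h | h | h | h <;> omega
  have hmin' : ∀ Z ∈ 𝔊, Θ * Z = Z → Z * Θ = -Z → Z ≠ 0 → Module.finrank ℂ (LinearMap.range B) ≤ Module.finrank ℂ (LinearMap.range Z) := by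
    rw [hr]; exact hmin
  obtain ⟨ι, Um, Up, PU, QU, Lm, ιm, Pm, Qm, Lp, ιp, Pp, Qp, hιmem, hιι, hιΘ, hιs, hUm, hUp, hfinUm, hfinUp,
    hPM, hQM, hPU, hQU, hrangeP, hPUP, hQUQ, hfinQM, hfinPU, hfinQU, hLm, hLp,
    hιmapply, hPmmem, hQmmem, hbrLm, hirrLm, hιmmem, hιmιm, hPm, hQm, hfinPm, hfinQm, hPmQm, hdefPm, hdefQm, hadjLm,
    hιpapply, hPpmem, hQpmem, hbrLp, hirrLp, hιpmem, hιpιp, hPp, hQp, hfinPp, hfinQp, hPpQp, hdefPp, hdefQp, hadjLp,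
    hsplit⟩ :=
    UnitaryLeviSetup.exists_levi_pair hbr hirr hΘ hΘΘ hP hQ hadd hsymm hPQ hdefP hdefQ hadj hB hΘB hBΘ
  have hdich : ∀ X ∈ 𝔊, Θ * X = X → X * Θ = -X → X * ι = ι * X →
      Module.finrank ℂ (Up.map X) + Module.finrank ℂ (Um.map X) ≤ Module.finrank ℂ (LinearMap.range B) ∨
        (23 ≤ Module.finrank ℂ (Up.map X) ∧ 23 ≤ Module.finrank ℂ (Um.map X)) := fun X hX hΘX hXΘ hXc =>
    UnitaryLeviSetup.profile_dichotomy hbr hΘΘ hP hQ hadd hsymm hPQ hdefP hdefQ hadj hmin hB hΘB hBΘ hιι hιΘ hιs hUm hUp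
      hPM hQM hQU hfinQU hrangeP hX hΘX hXΘ hXc
  have hfinQU' := hfinQU
  rw [hr] at hfinQM hfinPU hfinQU hfinPm hfinQm hfinPp hfinQp hsplit hdich
  rw [hQ51] at hfinQM hfinQm hfinUm
  rw [hP28] at hfinPU hfinPp hfinUp
  have hcm : ∀ Z : Module.End ℂ W, Z * ι = ι * Z → ∀ x ∈ Um, Z x ∈ Um := fun Z hZ x hx =>
    (hUm _).2 (by rw [← Module.End.mul_apply, ← hZ, Module.End.mul_apply, (hUm x).1 hx, map_neg])
  have hcp : ∀ Z : Module.End ℂ W, Z * ι = ι * Z → ∀ x ∈ Up, Z x ∈ Up := fun Z hZ x hx =>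
    (hUp _).2 (by rw [← Module.End.mul_apply, ← hZ, Module.End.mul_apply, (hUp x).1 hx])
  have hfullm_of : Lm = ⊤ → False := fun h =>
    UnitaryLeviSetup.false_of_full_larger hbr hΘΘ hno1 hιι hιΘ hUm hUp (by omega) (by omega) hPM hQM (by omega)
      (by omega) hLm h
  have hkillm23 : ∀ X ∈ 𝔊, Θ * X = X → X * Θ = -X → X * ι = ι * X → Module.finrank ℂ (Um.map X) ≠ 23 := by
    intro X hX hΘX hXΘ hXc h23
    obtain ⟨hxmem, hιmx, hxιm, hxrk⟩ := UnitaryLeviSetup.restrict_mem hcm hLm hιmapply X hX hΘX hXΘ hXc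
    rw [h23] at hxrk
    refine hfullm_of (UnitaryDoubleLevi.eq_top_of_raise_of_core hbrLm hirrLm hιmmem hιmιm hPm hQm
      (s := fun v w : Um => s (v : W) w) (hsU Um) (fun v w => hsymm v w) hPmQm hdefPm hdefQm hadjLm hxmem hιmx hxιm
      (by rw [hxrk]; omega) (by omega) (by omega)
      fun U' 𝔩' ι' P' Q' hbr𝔩' hirr𝔩' hι' hι'ι' hP' hQ' hfinP' hfinQ' hP'Q' hdefP' hdefQ' hadj𝔩' => ?_)
    rw [hxrk] at hfinP' hfinQ'
    exact UnitaryFive.eq_top_of_smul' hbr𝔩' hirr𝔩' hι' hι'ι' hP' hQ' (by omega) (by omega) (s := fun x y : U' => s ((x : Um) : W) y) (fun x y z => by simp only [Submodule.coe_add, hadd]) (fun c x y => by simp only [Submodule.coe_smul, hsmul]) (fun x y => hsymm _ _) hP'Q' hdefP' hdefQ' hadj𝔩'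
  have hLptop : Lp = ⊤ :=
    UnitaryFive.eq_top_of_smul hbrLp hirrLp hιpmem hιpιp hPp hQp (by omega) (by omega) (s := fun x y : Up => s (x : W) y) (fun x y z => by simp only [Submodule.coe_add, hadd]) (fun c x y => by simp only [Submodule.coe_smul, hsmul]) (fun x y => hsymm _ _) hPpQp hdefPp hdefQp hadjLp
  obtain ⟨T1, hιT1, hT1ι, hT1r⟩ := UnitaryRaisingSpace.exists_raise_finrank_range_eq hιpιp hPp hQp (k := 1)
    (by omega) (by omega)
  obtain ⟨X1, hX1, hΘX1, hX1Θ, hX1c, hX1Up⟩ := UnitaryLeviSetup.exists_lift hbr hΘ hΘΘ hcp hιΘ hLp hιpapply T1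
    (by rw [hLptop]; exact Submodule.mem_top) hιT1 hT1ι
  rw [hT1r] at hX1Up
  obtain ⟨hs1, hi1, hi1', hj1, hj1'⟩ := hsplit X1 hΘX1 hX1Θ hX1c
  have hrk1 := hS X1 hX1 hΘX1 hX1Θ
  have hd1 := hdich X1 hX1 hΘX1 hX1Θ hX1c
  rw [hs1] at hrk1
  rw [hX1Up] at hrk1 hd1
  obtain ⟨T2, hιT2, hT2ι, hT2r⟩ := UnitaryRaisingSpace.exists_raise_finrank_range_eq hιpιp hPp hQp (k := 2)
    (by omega) (by omega)
  obtain ⟨X2, hX2, hΘX2, hX2Θ, hX2c, hX2Up⟩ := UnitaryLeviSetup.exists_lift hbr hΘ hΘΘ hcp hιΘ hLp hιpapply T2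
    (by rw [hLptop]; exact Submodule.mem_top) hιT2 hT2ι
  rw [hT2r] at hX2Up
  obtain ⟨hs2, hi2, hi2', hj2, hj2'⟩ := hsplit X2 hΘX2 hX2Θ hX2c
  have hrk2 := hS X2 hX2 hΘX2 hX2Θ
  have hd2 := hdich X2 hX2 hΘX2 hX2Θ hX2c
  rw [hs2] at hrk2
  rw [hX2Up] at hrk2 hd2
  have hprof : ∀ X ∈ 𝔊, Θ * X = X → X * Θ = -X → X * ι = ι * X →
      (Module.finrank ℂ (Up.map X) + Module.finrank ℂ (Um.map X) = 0 ∨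
        Module.finrank ℂ (Up.map X) + Module.finrank ℂ (Um.map X) = 23) ∧ Module.finrank ℂ (Up.map X) ≤ 5 := by
    intro X hX hΘX hXΘ hXc
    obtain ⟨hs, hi, hi', hj, hj'⟩ := hsplit X hΘX hXΘ hXc
    have hkillm23' := hkillm23 X hX hΘX hXΘ hXc
    have hrk := hS X hX hΘX hXΘ
    have hd := hdich X hX hΘX hXΘ hXc
    rw [hs] at hrk
    omega
  have hnotboth : ∀ X ∈ 𝔊, Θ * X = X → X * Θ = -X → X * ι = ι * X → ∀ X' ∈ 𝔊, Θ * X' = X' → X' * Θ = -X' →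
      X' * ι = ι * X' → 23 < Module.finrank ℂ (Up.map X') + Module.finrank ℂ (Um.map X) → False := by
    intro X hX hΘX hXΘ hXc X' hX' hΘX' hX'Θ hX'c hgt
    obtain ⟨c, hc1, hc2⟩ := UnitaryGenericRank.exists_finrank_le_and_finrank_le (X'.restrict (hcp X' hX'c))
      (X.restrict (hcp X hXc)) (X.restrict (hcm X hXc)) (X'.restrict (hcm X' hX'c))
    obtain ⟨hX₁, hΘX₁, hX₁Θ, hX₁c⟩ := UnitaryLeviSetup.add_smul_raise X hX hΘX hXΘ hXc X' hX' hΘX' hX'Θ hX'c c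
    have hi₁ := UnitaryLeviSetup.finrank_map_add_smul hcp X X' hXc hX'c c hX₁c
    have hj₁ := UnitaryLeviSetup.finrank_map_add_smul hcm X X' hXc hX'c c hX₁c
    rw [UnitaryLeviRank.finrank_range_restrict] at hc1 hc2
    have hp := hprof (X + c • X') hX₁ hΘX₁ hX₁Θ hX₁c
    rw [hi₁, hj₁] at hp
    omega
  exact hnotboth X1 hX1 hΘX1 hX1Θ hX1c X2 hX2 hΘX2 hX2Θ hX2c (by omega)

/-- `(28 | 51)`, minimal rank `24`: after the Levi kills every profile has `i = 0` (profiles [(0, 0), (0, 24)]), against the non-vanishing lemma. [cite: Ribet1983, Thm. 3] [cite: Gordon1997, Thm. 6.3 (3)]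
[cite: Deligne1982HodgeCycles, I §3 Prop. 3.4, 3.6] [cite: GoodmanWallachGTM255, §4.1.1] -/
theorem UnitaryTwentyEightFiftyOne.no_minRank_24 [FiniteDimensional ℂ W] {𝔊 : Submodule ℂ (Module.End ℂ W)}
    (hbr : ∀ Y ∈ 𝔊, ∀ Z ∈ 𝔊, Y * Z - Z * Y ∈ 𝔊)
    (hirr : ∀ U : Submodule ℂ W, (∀ A ∈ 𝔊, ∀ u ∈ U, A u ∈ U) → U = ⊥ ∨ U = ⊤)
    {Θ : Module.End ℂ W} (hΘ : Θ ∈ 𝔊) (hΘΘ : Θ * Θ = 1)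
    {P Q : Submodule ℂ W} (hP : ∀ x, x ∈ P ↔ Θ x = x) (hQ : ∀ x, x ∈ Q ↔ Θ x = -x)
    (hP28 : Module.finrank ℂ P = 28) (hQ51 : Module.finrank ℂ Q = 51)
    {s : W → W → ℂ} (hadd : ∀ x y z, s (x + y) z = s x z + s y z)
    (hsmul : ∀ (c : ℂ) (x y : W), s (c • x) y = c * s x y) (hsymm : ∀ x y, s y x = starRingEnd ℂ (s x y))
    (hPQ : ∀ p ∈ P, ∀ q ∈ Q, s p q = 0) (hdefP : ∀ p ∈ P, s p p = 0 → p = 0) (hdefQ : ∀ q ∈ Q, s q q = 0 → q = 0)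
    (hadj : ∀ X ∈ 𝔊, ∃ Y ∈ 𝔊, ∀ x y, s (X x) y = s x (Y y))
    (hS : ∀ B' ∈ 𝔊, Θ * B' = B' → B' * Θ = -B' →
      Module.finrank ℂ (LinearMap.range B') = 0 ∨ Module.finrank ℂ (LinearMap.range B') = 24 ∨ Module.finrank ℂ (LinearMap.range B') = 25 ∨ Module.finrank ℂ (LinearMap.range B') = 26 ∨ Module.finrank ℂ (LinearMap.range B') = 27 ∨ Module.finrank ℂ (LinearMap.range B') = 28)
    {B : Module.End ℂ W} (hB : B ∈ 𝔊) (hΘB : Θ * B = B) (hBΘ : B * Θ = -B)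
    (hr : Module.finrank ℂ (LinearMap.range B) = 24) : False := by
  classical
  have hsU : ∀ U : Submodule ℂ W, ∀ x y z : U, s ((x + y : U) : W) z = s (x : W) z + s (y : W) z :=
    fun U x y z => by simp only [Submodule.coe_add, hadd]
  have hsmU : ∀ U : Submodule ℂ W, ∀ (c : ℂ) (x y : U), s ((c • x : U) : W) y = c * s (x : W) y :=
    fun U c x y => by simp only [Submodule.coe_smul, hsmul]
  have hno1 : ∀ B' ∈ 𝔊, Θ * B' = B' → B' * Θ = -B' → Module.finrank ℂ (LinearMap.range B') ≠ 1 := by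
    intro B' hB' hΘB' hB'Θ h1
    rcases hS B' hB' hΘB' hB'Θ with h | h | h | h | h | h <;> omega
  have hmin : ∀ Y ∈ 𝔊, Θ * Y = Y → Y * Θ = -Y → Y ≠ 0 → 24 ≤ Module.finrank ℂ (LinearMap.range Y) := by
    intro Y hY hΘY hYΘ hY0
    have h0 : Module.finrank ℂ (LinearMap.range Y) ≠ 0 := fun h =>
      hY0 (LinearMap.range_eq_bot.1 (Submodule.finrank_eq_zero.1 h))
    rcases hS Y hY hΘY hYΘ with h | h | h | h | h | h <;> omega
  have hmin' : ∀ Z ∈ 𝔊, Θ * Z = Z → Z * Θ = -Z → Z ≠ 0 → Module.finrank ℂ (LinearMap.range B) ≤ Module.finrank ℂ (LinearMap.range Z) := by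
    rw [hr]; exact hmin
  obtain ⟨ι, Um, Up, PU, QU, Lm, ιm, Pm, Qm, Lp, ιp, Pp, Qp, hιmem, hιι, hιΘ, hιs, hUm, hUp, hfinUm, hfinUp,
    hPM, hQM, hPU, hQU, hrangeP, hPUP, hQUQ, hfinQM, hfinPU, hfinQU, hLm, hLp,
    hιmapply, hPmmem, hQmmem, hbrLm, hirrLm, hιmmem, hιmιm, hPm, hQm, hfinPm, hfinQm, hPmQm, hdefPm, hdefQm, hadjLm,
    hιpapply, hPpmem, hQpmem, hbrLp, hirrLp, hιpmem, hιpιp, hPp, hQp, hfinPp, hfinQp, hPpQp, hdefPp, hdefQp, hadjLp,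
    hsplit⟩ :=
    UnitaryLeviSetup.exists_levi_pair hbr hirr hΘ hΘΘ hP hQ hadd hsymm hPQ hdefP hdefQ hadj hB hΘB hBΘ
  have hdich : ∀ X ∈ 𝔊, Θ * X = X → X * Θ = -X → X * ι = ι * X →
      Module.finrank ℂ (Up.map X) + Module.finrank ℂ (Um.map X) ≤ Module.finrank ℂ (LinearMap.range B) ∨
        (24 ≤ Module.finrank ℂ (Up.map X) ∧ 24 ≤ Module.finrank ℂ (Um.map X)) := fun X hX hΘX hXΘ hXc =>
    UnitaryLeviSetup.profile_dichotomy hbr hΘΘ hP hQ hadd hsymm hPQ hdefP hdefQ hadj hmin hB hΘB hBΘ hιι hιΘ hιs hUm hUp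
      hPM hQM hQU hfinQU hrangeP hX hΘX hXΘ hXc
  have hfinQU' := hfinQU
  rw [hr] at hfinQM hfinPU hfinQU hfinPm hfinQm hfinPp hfinQp hsplit hdich
  rw [hQ51] at hfinQM hfinQm hfinUm
  rw [hP28] at hfinPU hfinPp hfinUp
  have hcm : ∀ Z : Module.End ℂ W, Z * ι = ι * Z → ∀ x ∈ Um, Z x ∈ Um := fun Z hZ x hx =>
    (hUm _).2 (by rw [← Module.End.mul_apply, ← hZ, Module.End.mul_apply, (hUm x).1 hx, map_neg])
  have hcp : ∀ Z : Module.End ℂ W, Z * ι = ι * Z → ∀ x ∈ Up, Z x ∈ Up := fun Z hZ x hx =>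
    (hUp _).2 (by rw [← Module.End.mul_apply, ← hZ, Module.End.mul_apply, (hUp x).1 hx])
  have hfullm_of : Lm = ⊤ → False := fun h =>
    UnitaryLeviSetup.false_of_full_larger hbr hΘΘ hno1 hιι hιΘ hUm hUp (by omega) (by omega) hPM hQM (by omega)
      (by omega) hLm h
  have hkillm20 : ∀ X ∈ 𝔊, Θ * X = X → X * Θ = -X → X * ι = ι * X → Module.finrank ℂ (Um.map X) ≠ 20 := by
    intro X hX hΘX hXΘ hXc h20
    obtain ⟨hxmem, hιmx, hxιm, hxrk⟩ := UnitaryLeviSetup.restrict_mem hcm hLm hιmapply X hX hΘX hXΘ hXc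
    rw [h20] at hxrk
    refine hfullm_of (UnitaryDoubleLevi.eq_top_of_raise_of_core hbrLm hirrLm hιmmem hιmιm hPm hQm
      (s := fun v w : Um => s (v : W) w) (hsU Um) (fun v w => hsymm v w) hPmQm hdefPm hdefQm hadjLm hxmem hιmx hxιm
      (by rw [hxrk]; omega) (by omega) (by omega)
      fun U' 𝔩' ι' P' Q' hbr𝔩' hirr𝔩' hι' hι'ι' hP' hQ' hfinP' hfinQ' hP'Q' hdefP' hdefQ' hadj𝔩' => ?_)
    rw [hxrk] at hfinP' hfinQ'
    exact UnitarySeven.eq_top_of_smul' hbr𝔩' hirr𝔩' hι' hι'ι' hP' hQ' (by omega) (by omega) (s := fun x y : U' => s ((x : Um) : W) y) (fun x y z => by simp only [Submodule.coe_add, hadd]) (fun c x y => by simp only [Submodule.coe_smul, hsmul]) (fun x y => hsymm _ _) hP'Q' hdefP' hdefQ' hadj𝔩'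
  have hkillm22 : ∀ X ∈ 𝔊, Θ * X = X → X * Θ = -X → X * ι = ι * X → Module.finrank ℂ (Um.map X) ≠ 22 := by
    intro X hX hΘX hXΘ hXc h22
    obtain ⟨hxmem, hιmx, hxιm, hxrk⟩ := UnitaryLeviSetup.restrict_mem hcm hLm hιmapply X hX hΘX hXΘ hXc
    rw [h22] at hxrk
    refine hfullm_of (UnitaryDoubleLevi.eq_top_of_raise_of_core hbrLm hirrLm hιmmem hιmιm hPm hQm
      (s := fun v w : Um => s (v : W) w) (hsU Um) (fun v w => hsymm v w) hPmQm hdefPm hdefQm hadjLm hxmem hιmx hxιm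
      (by rw [hxrk]; omega) (by omega) (by omega)
      fun U' 𝔩' ι' P' Q' hbr𝔩' hirr𝔩' hι' hι'ι' hP' hQ' hfinP' hfinQ' hP'Q' hdefP' hdefQ' hadj𝔩' => ?_)
    rw [hxrk] at hfinP' hfinQ'
    exact UnitaryFive.eq_top_of_smul' hbr𝔩' hirr𝔩' hι' hι'ι' hP' hQ' (by omega) (by omega) (s := fun x y : U' => s ((x : Um) : W) y) (fun x y z => by simp only [Submodule.coe_add, hadd]) (fun c x y => by simp only [Submodule.coe_smul, hsmul]) (fun x y => hsymm _ _) hP'Q' hdefP' hdefQ' hadj𝔩'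
  have hkillm23 : ∀ X ∈ 𝔊, Θ * X = X → X * Θ = -X → X * ι = ι * X → Module.finrank ℂ (Um.map X) ≠ 23 := by
    intro X hX hΘX hXΘ hXc h23
    obtain ⟨hxmem, hιmx, hxιm, hxrk⟩ := UnitaryLeviSetup.restrict_mem hcm hLm hιmapply X hX hΘX hXΘ hXc
    rw [h23] at hxrk
    refine hfullm_of (UnitaryDoubleLevi.eq_top_of_raise_of_core hbrLm hirrLm hιmmem hιmιm hPm hQm
      (s := fun v w : Um => s (v : W) w) (hsU Um) (fun v w => hsymm v w) hPmQm hdefPm hdefQm hadjLm hxmem hιmx hxιm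
      (by rw [hxrk]; omega) (by omega) (by omega)
      fun U' 𝔩' ι' P' Q' hbr𝔩' hirr𝔩' hι' hι'ι' hP' hQ' hfinP' hfinQ' hP'Q' hdefP' hdefQ' hadj𝔩' => ?_)
    rw [hxrk] at hfinP' hfinQ'
    exact UnitaryFourOdd.eq_top' hbr𝔩' hirr𝔩' hι' hι'ι' hP' hQ' ⟨11, by omega⟩ (by omega) (s := fun x y : U' => s ((x : Um) : W) y) (fun x y z => by simp only [Submodule.coe_add, hadd]) (fun x y => hsymm _ _) hP'Q' hdefP' hdefQ' hadj𝔩'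
  have hfullp_of : Lp = ⊤ → False := by
    intro hLptop
    obtain ⟨T1, hιT1, hT1ι, hT1r⟩ := UnitaryRaisingSpace.exists_raise_finrank_range_eq hιpιp hPp hQp (k := 1)
      (by omega) (by omega)
    obtain ⟨X1, hX1, hΘX1, hX1Θ, hX1c, hX1Up⟩ := UnitaryLeviSetup.exists_lift hbr hΘ hΘΘ hcp hιΘ hLp hιpapply T1
      (by rw [hLptop]; exact Submodule.mem_top) hιT1 hT1ι
    rw [hT1r] at hX1Up
    obtain ⟨hs1, hi1, hi1', hj1, hj1'⟩ := hsplit X1 hΘX1 hX1Θ hX1c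
    have hrk1 := hS X1 hX1 hΘX1 hX1Θ
    have hd1 := hdich X1 hX1 hΘX1 hX1Θ hX1c
    rw [hs1] at hrk1
    rw [hX1Up] at hrk1 hd1
    have hk_hkillm23 := hkillm23 X1 hX1 hΘX1 hX1Θ hX1c
    omega
  have hprof0 : ∀ X ∈ 𝔊, Θ * X = X → X * Θ = -X → X * ι = ι * X →
      (Module.finrank ℂ (Up.map X) = 0 ∧ Module.finrank ℂ (Um.map X) = 0) ∨
        (Module.finrank ℂ (Up.map X) = 0 ∧ Module.finrank ℂ (Um.map X) = 24) ∨
        (Module.finrank ℂ (Up.map X) = 3 ∧ Module.finrank ℂ (Um.map X) = 21) := by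
    intro X hX hΘX hXΘ hXc
    obtain ⟨hs, hi, hi', hj, hj'⟩ := hsplit X hΘX hXΘ hXc
    have hkillm20' := hkillm20 X hX hΘX hXΘ hXc
    have hkillm22' := hkillm22 X hX hΘX hXΘ hXc
    have hkillm23' := hkillm23 X hX hΘX hXΘ hXc
    have hrk := hS X hX hΘX hXΘ
    have hd := hdich X hX hΘX hXΘ hXc
    rw [hs] at hrk
    generalize Module.finrank ℂ ↥(Submodule.map X Um) = jj at *
    have hjle : jj ≤ 24 := by omega
    interval_cases jj
    · exact Or.inl ⟨by omega, rfl⟩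
    · exfalso; omega
    · exfalso; omega
    · exfalso; omega
    · exfalso; omega
    · exfalso; omega
    · exfalso; omega
    · exfalso; omega
    · exfalso; omega
    · exfalso; omega
    · exfalso; omega
    · exfalso; omega
    · exfalso; omega
    · exfalso; omega
    · exfalso; omega
    · exfalso; omega
    · exfalso; omega
    · exfalso; omega
    · exfalso; omega
    · exfalso; omega
    · exact (hkillm20' rfl).elim
    · exact Or.inr (Or.inr (⟨by omega, rfl⟩))
    · exact (hkillm22' rfl).elim
    · exact (hkillm23' rfl).elim
    · exact Or.inr (Or.inl ⟨by omega, rfl⟩)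
  have hkillmF21 : ∀ X ∈ 𝔊, Θ * X = X → X * Θ = -X → X * ι = ι * X → Module.finrank ℂ (Um.map X) ≠ 21 := by
    intro X hX hΘX hXΘ hXc h21
    obtain ⟨hxmem, hιmx, hxιm, hxrk⟩ := UnitaryLeviSetup.restrict_mem hcm hLm hιmapply X hX hΘX hXΘ hXc
    rw [h21] at hxrk
    refine UnitaryConstantRank.false_of_le_rank hbrLm hirrLm hιmmem hιmιm hPm hQm (s := fun v w : Um => s (v : W) w)
      (hsU Um) (fun v w => hsymm v w) hPmQm hdefPm hdefQm hadjLm hxmem hιmx hxιm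
      (by rw [hxrk]; omega) (by rw [hxrk]; omega) fun A hA hιmA hAιm hAne => ?_
    obtain ⟨X', hX', hΘX', hX'Θ, hX'c, hX'Um⟩ :=
      UnitaryLeviSetup.exists_lift hbr hΘ hΘΘ hcm hιΘ hLm hιmapply A hA hιmA hAιm
    have hA0 : Module.finrank ℂ (LinearMap.range A) ≠ 0 := fun h =>
      hAne (LinearMap.range_eq_bot.1 (Submodule.finrank_eq_zero.1 h))
    have hp := hprof0 X' hX' hΘX' hX'Θ hX'c
    rw [← hX'Um] at hA0
    rw [hxrk, ← hX'Um]
    omega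
  have hprof : ∀ X ∈ 𝔊, Θ * X = X → X * Θ = -X → X * ι = ι * X →
      (Module.finrank ℂ (Up.map X) = 0 ∧ Module.finrank ℂ (Um.map X) = 0) ∨
        (Module.finrank ℂ (Up.map X) = 0 ∧ Module.finrank ℂ (Um.map X) = 24) := by
    intro X hX hΘX hXΘ hXc
    have hp := hprof0 X hX hΘX hXΘ hXc
    have hkillmF21' := hkillmF21 X hX hΘX hXΘ hXc
    omega
  obtain ⟨⟨p, hp⟩, hp0⟩ := Module.finrank_pos_iff_exists_ne_zero.1 (show 0 < Module.finrank ℂ PU by omega)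
  obtain ⟨⟨q, hq⟩, hq0⟩ := Module.finrank_pos_iff_exists_ne_zero.1 (show 0 < Module.finrank ℂ QU by omega)
  obtain ⟨X₀, hX₀, hΘX₀, hX₀Θ, hX₀c, c₀, hιc₀, -, hX₀c0⟩ :=
    UnitaryLeviFull.exists_raise_commute_apply_ne_zero hbr hirr hΘ hΘΘ hQ hιmem hιι hιΘ hUm hUp
      ⟨p, fun h => hp0 (Subtype.ext h), ((hPU p).1 hp).1, ((hPU p).1 hp).2⟩
      ⟨q, fun h => hq0 (Subtype.ext h), ((hQU q).1 hq).1, ((hQU q).1 hq).2⟩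
  have hX₀i : Module.finrank ℂ (Up.map X₀) ≠ 0 := fun h0 => by
    have hmem : X₀ c₀ ∈ Up.map X₀ := Submodule.mem_map_of_mem ((hUp c₀).2 hιc₀)
    rw [Submodule.finrank_eq_zero.1 h0, Submodule.mem_bot] at hmem
    exact hX₀c0 hmem
  have hp0 := hprof X₀ hX₀ hΘX₀ hX₀Θ hX₀c
  omega

/-- `(28 | 51)`, minimal rank `25`: `L⁺` of type `(3 | 25)` is full and a lift with `i = 2` has `j ∈ {23}`, killed in `L⁻` (type `(25 | 26)`). [cite: Ribet1983, Thm. 3] [cite: Gordon1997, Thm. 6.3 (3)]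
[cite: Deligne1982HodgeCycles, I §3 Prop. 3.4, 3.6] [cite: GoodmanWallachGTM255, §4.1.1] -/
theorem UnitaryTwentyEightFiftyOne.no_minRank_25 [FiniteDimensional ℂ W] {𝔊 : Submodule ℂ (Module.End ℂ W)}
    (hbr : ∀ Y ∈ 𝔊, ∀ Z ∈ 𝔊, Y * Z - Z * Y ∈ 𝔊)
    (hirr : ∀ U : Submodule ℂ W, (∀ A ∈ 𝔊, ∀ u ∈ U, A u ∈ U) → U = ⊥ ∨ U = ⊤)
    {Θ : Module.End ℂ W} (hΘ : Θ ∈ 𝔊) (hΘΘ : Θ * Θ = 1)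
    {P Q : Submodule ℂ W} (hP : ∀ x, x ∈ P ↔ Θ x = x) (hQ : ∀ x, x ∈ Q ↔ Θ x = -x)
    (hP28 : Module.finrank ℂ P = 28) (hQ51 : Module.finrank ℂ Q = 51)
    {s : W → W → ℂ} (hadd : ∀ x y z, s (x + y) z = s x z + s y z)
    (hsmul : ∀ (c : ℂ) (x y : W), s (c • x) y = c * s x y) (hsymm : ∀ x y, s y x = starRingEnd ℂ (s x y))
    (hPQ : ∀ p ∈ P, ∀ q ∈ Q, s p q = 0) (hdefP : ∀ p ∈ P, s p p = 0 → p = 0) (hdefQ : ∀ q ∈ Q, s q q = 0 → q = 0)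
    (hadj : ∀ X ∈ 𝔊, ∃ Y ∈ 𝔊, ∀ x y, s (X x) y = s x (Y y))
    (hS : ∀ B' ∈ 𝔊, Θ * B' = B' → B' * Θ = -B' →
      Module.finrank ℂ (LinearMap.range B') = 0 ∨ Module.finrank ℂ (LinearMap.range B') = 25 ∨ Module.finrank ℂ (LinearMap.range B') = 26 ∨ Module.finrank ℂ (LinearMap.range B') = 27 ∨ Module.finrank ℂ (LinearMap.range B') = 28)
    {B : Module.End ℂ W} (hB : B ∈ 𝔊) (hΘB : Θ * B = B) (hBΘ : B * Θ = -B)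
    (hr : Module.finrank ℂ (LinearMap.range B) = 25) : False := by
  classical
  have hsU : ∀ U : Submodule ℂ W, ∀ x y z : U, s ((x + y : U) : W) z = s (x : W) z + s (y : W) z :=
    fun U x y z => by simp only [Submodule.coe_add, hadd]
  have hsmU : ∀ U : Submodule ℂ W, ∀ (c : ℂ) (x y : U), s ((c • x : U) : W) y = c * s (x : W) y :=
    fun U c x y => by simp only [Submodule.coe_smul, hsmul]
  have hno1 : ∀ B' ∈ 𝔊, Θ * B' = B' → B' * Θ = -B' → Module.finrank ℂ (LinearMap.range B') ≠ 1 := by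
    intro B' hB' hΘB' hB'Θ h1
    rcases hS B' hB' hΘB' hB'Θ with h | h | h | h | h <;> omega
  have hmin : ∀ Y ∈ 𝔊, Θ * Y = Y → Y * Θ = -Y → Y ≠ 0 → 25 ≤ Module.finrank ℂ (LinearMap.range Y) := by
    intro Y hY hΘY hYΘ hY0
    have h0 : Module.finrank ℂ (LinearMap.range Y) ≠ 0 := fun h =>
      hY0 (LinearMap.range_eq_bot.1 (Submodule.finrank_eq_zero.1 h))
    rcases hS Y hY hΘY hYΘ with h | h | h | h | h <;> omega
  have hmin' : ∀ Z ∈ 𝔊, Θ * Z = Z → Z * Θ = -Z → Z ≠ 0 → Module.finrank ℂ (LinearMap.range B) ≤ Module.finrank ℂ (LinearMap.range Z) := by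
    rw [hr]; exact hmin
  obtain ⟨ι, Um, Up, PU, QU, Lm, ιm, Pm, Qm, Lp, ιp, Pp, Qp, hιmem, hιι, hιΘ, hιs, hUm, hUp, hfinUm, hfinUp,
    hPM, hQM, hPU, hQU, hrangeP, hPUP, hQUQ, hfinQM, hfinPU, hfinQU, hLm, hLp,
    hιmapply, hPmmem, hQmmem, hbrLm, hirrLm, hιmmem, hιmιm, hPm, hQm, hfinPm, hfinQm, hPmQm, hdefPm, hdefQm, hadjLm,
    hιpapply, hPpmem, hQpmem, hbrLp, hirrLp, hιpmem, hιpιp, hPp, hQp, hfinPp, hfinQp, hPpQp, hdefPp, hdefQp, hadjLp,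
    hsplit⟩ :=
    UnitaryLeviSetup.exists_levi_pair hbr hirr hΘ hΘΘ hP hQ hadd hsymm hPQ hdefP hdefQ hadj hB hΘB hBΘ
  have hdich : ∀ X ∈ 𝔊, Θ * X = X → X * Θ = -X → X * ι = ι * X →
      Module.finrank ℂ (Up.map X) + Module.finrank ℂ (Um.map X) ≤ Module.finrank ℂ (LinearMap.range B) ∨
        (25 ≤ Module.finrank ℂ (Up.map X) ∧ 25 ≤ Module.finrank ℂ (Um.map X)) := fun X hX hΘX hXΘ hXc =>
    UnitaryLeviSetup.profile_dichotomy hbr hΘΘ hP hQ hadd hsymm hPQ hdefP hdefQ hadj hmin hB hΘB hBΘ hιι hιΘ hιs hUm hUp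
      hPM hQM hQU hfinQU hrangeP hX hΘX hXΘ hXc
  have hfinQU' := hfinQU
  rw [hr] at hfinQM hfinPU hfinQU hfinPm hfinQm hfinPp hfinQp hsplit hdich
  rw [hQ51] at hfinQM hfinQm hfinUm
  rw [hP28] at hfinPU hfinPp hfinUp
  have hcm : ∀ Z : Module.End ℂ W, Z * ι = ι * Z → ∀ x ∈ Um, Z x ∈ Um := fun Z hZ x hx =>
    (hUm _).2 (by rw [← Module.End.mul_apply, ← hZ, Module.End.mul_apply, (hUm x).1 hx, map_neg])
  have hcp : ∀ Z : Module.End ℂ W, Z * ι = ι * Z → ∀ x ∈ Up, Z x ∈ Up := fun Z hZ x hx =>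
    (hUp _).2 (by rw [← Module.End.mul_apply, ← hZ, Module.End.mul_apply, (hUp x).1 hx])
  have hfullm_of : Lm = ⊤ → False := fun h =>
    UnitaryLeviSetup.false_of_full_larger hbr hΘΘ hno1 hιι hιΘ hUm hUp (by omega) (by omega) hPM hQM (by omega)
      (by omega) hLm h
  have hkillm23 : ∀ X ∈ 𝔊, Θ * X = X → X * Θ = -X → X * ι = ι * X → Module.finrank ℂ (Um.map X) ≠ 23 := by
    intro X hX hΘX hXΘ hXc h23
    obtain ⟨hxmem, hιmx, hxιm, hxrk⟩ := UnitaryLeviSetup.restrict_mem hcm hLm hιmapply X hX hΘX hXΘ hXc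
    rw [h23] at hxrk
    refine hfullm_of (UnitaryDoubleLevi.eq_top_of_raise_of_core hbrLm hirrLm hιmmem hιmιm hPm hQm
      (s := fun v w : Um => s (v : W) w) (hsU Um) (fun v w => hsymm v w) hPmQm hdefPm hdefQm hadjLm hxmem hιmx hxιm
      (by rw [hxrk]; omega) (by omega) (by omega)
      fun U' 𝔩' ι' P' Q' hbr𝔩' hirr𝔩' hι' hι'ι' hP' hQ' hfinP' hfinQ' hP'Q' hdefP' hdefQ' hadj𝔩' => ?_)
    rw [hxrk] at hfinP' hfinQ'
    exact UnitaryThreeCoprime.eq_top' hbr𝔩' hirr𝔩' hι' hι'ι' hP' hQ' (by omega) (by omega) (s := fun x y : U' => s ((x : Um) : W) y) (fun x y z => by simp only [Submodule.coe_add, hadd]) (fun x y => hsymm _ _) hP'Q' hdefP' hdefQ' hadj𝔩'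
  have hLptop : Lp = ⊤ :=
    UnitaryThreeCoprime.eq_top hbrLp hirrLp hιpmem hιpιp hPp hQp (by omega) (by omega) (s := fun x y : Up => s (x : W) y) (fun x y z => by simp only [Submodule.coe_add, hadd]) (fun x y => hsymm _ _) hPpQp hdefPp hdefQp hadjLp
  obtain ⟨T2, hιT2, hT2ι, hT2r⟩ := UnitaryRaisingSpace.exists_raise_finrank_range_eq hιpιp hPp hQp (k := 2)
    (by omega) (by omega)
  obtain ⟨X2, hX2, hΘX2, hX2Θ, hX2c, hX2Up⟩ := UnitaryLeviSetup.exists_lift hbr hΘ hΘΘ hcp hιΘ hLp hιpapply T2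
    (by rw [hLptop]; exact Submodule.mem_top) hιT2 hT2ι
  rw [hT2r] at hX2Up
  obtain ⟨hs2, hi2, hi2', hj2, hj2'⟩ := hsplit X2 hΘX2 hX2Θ hX2c
  have hrk2 := hS X2 hX2 hΘX2 hX2Θ
  have hd2 := hdich X2 hX2 hΘX2 hX2Θ hX2c
  rw [hs2] at hrk2
  rw [hX2Up] at hrk2 hd2
  have hk_hkillm23 := hkillm23 X2 hX2 hΘX2 hX2Θ hX2c
  omega

/-- `(28 | 51)`, minimal rank `26`: after the Levi kills every profile has `i = 0` (profiles [(0, 0)]), against the non-vanishing lemma. [cite: Ribet1983, Thm. 3] [cite: Gordon1997, Thm. 6.3 (3)]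
[cite: Deligne1982HodgeCycles, I §3 Prop. 3.4, 3.6] [cite: GoodmanWallachGTM255, §4.1.1] -/
theorem UnitaryTwentyEightFiftyOne.no_minRank_26 [FiniteDimensional ℂ W] {𝔊 : Submodule ℂ (Module.End ℂ W)}
    (hbr : ∀ Y ∈ 𝔊, ∀ Z ∈ 𝔊, Y * Z - Z * Y ∈ 𝔊)
    (hirr : ∀ U : Submodule ℂ W, (∀ A ∈ 𝔊, ∀ u ∈ U, A u ∈ U) → U = ⊥ ∨ U = ⊤)
    {Θ : Module.End ℂ W} (hΘ : Θ ∈ 𝔊) (hΘΘ : Θ * Θ = 1)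
    {P Q : Submodule ℂ W} (hP : ∀ x, x ∈ P ↔ Θ x = x) (hQ : ∀ x, x ∈ Q ↔ Θ x = -x)
    (hP28 : Module.finrank ℂ P = 28) (hQ51 : Module.finrank ℂ Q = 51)
    {s : W → W → ℂ} (hadd : ∀ x y z, s (x + y) z = s x z + s y z)
    (hsmul : ∀ (c : ℂ) (x y : W), s (c • x) y = c * s x y) (hsymm : ∀ x y, s y x = starRingEnd ℂ (s x y))
    (hPQ : ∀ p ∈ P, ∀ q ∈ Q, s p q = 0) (hdefP : ∀ p ∈ P, s p p = 0 → p = 0) (hdefQ : ∀ q ∈ Q, s q q = 0 → q = 0)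
    (hadj : ∀ X ∈ 𝔊, ∃ Y ∈ 𝔊, ∀ x y, s (X x) y = s x (Y y))
    (hS : ∀ B' ∈ 𝔊, Θ * B' = B' → B' * Θ = -B' →
      Module.finrank ℂ (LinearMap.range B') = 0 ∨ Module.finrank ℂ (LinearMap.range B') = 26 ∨ Module.finrank ℂ (LinearMap.range B') = 27 ∨ Module.finrank ℂ (LinearMap.range B') = 28)
    {B : Module.End ℂ W} (hB : B ∈ 𝔊) (hΘB : Θ * B = B) (hBΘ : B * Θ = -B)
    (hr : Module.finrank ℂ (LinearMap.range B) = 26) : False := by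
  classical
  have hsU : ∀ U : Submodule ℂ W, ∀ x y z : U, s ((x + y : U) : W) z = s (x : W) z + s (y : W) z :=
    fun U x y z => by simp only [Submodule.coe_add, hadd]
  have hsmU : ∀ U : Submodule ℂ W, ∀ (c : ℂ) (x y : U), s ((c • x : U) : W) y = c * s (x : W) y :=
    fun U c x y => by simp only [Submodule.coe_smul, hsmul]
  have hno1 : ∀ B' ∈ 𝔊, Θ * B' = B' → B' * Θ = -B' → Module.finrank ℂ (LinearMap.range B') ≠ 1 := by
    intro B' hB' hΘB' hB'Θ h1
    rcases hS B' hB' hΘB' hB'Θ with h | h | h | h <;> omega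
  have hmin : ∀ Y ∈ 𝔊, Θ * Y = Y → Y * Θ = -Y → Y ≠ 0 → 26 ≤ Module.finrank ℂ (LinearMap.range Y) := by
    intro Y hY hΘY hYΘ hY0
    have h0 : Module.finrank ℂ (LinearMap.range Y) ≠ 0 := fun h =>
      hY0 (LinearMap.range_eq_bot.1 (Submodule.finrank_eq_zero.1 h))
    rcases hS Y hY hΘY hYΘ with h | h | h | h <;> omega
  have hmin' : ∀ Z ∈ 𝔊, Θ * Z = Z → Z * Θ = -Z → Z ≠ 0 → Module.finrank ℂ (LinearMap.range B) ≤ Module.finrank ℂ (LinearMap.range Z) := by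
    rw [hr]; exact hmin
  obtain ⟨ι, Um, Up, PU, QU, Lm, ιm, Pm, Qm, Lp, ιp, Pp, Qp, hιmem, hιι, hιΘ, hιs, hUm, hUp, hfinUm, hfinUp,
    hPM, hQM, hPU, hQU, hrangeP, hPUP, hQUQ, hfinQM, hfinPU, hfinQU, hLm, hLp,
    hιmapply, hPmmem, hQmmem, hbrLm, hirrLm, hιmmem, hιmιm, hPm, hQm, hfinPm, hfinQm, hPmQm, hdefPm, hdefQm, hadjLm,
    hιpapply, hPpmem, hQpmem, hbrLp, hirrLp, hιpmem, hιpιp, hPp, hQp, hfinPp, hfinQp, hPpQp, hdefPp, hdefQp, hadjLp,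
    hsplit⟩ :=
    UnitaryLeviSetup.exists_levi_pair hbr hirr hΘ hΘΘ hP hQ hadd hsymm hPQ hdefP hdefQ hadj hB hΘB hBΘ
  have hdich : ∀ X ∈ 𝔊, Θ * X = X → X * Θ = -X → X * ι = ι * X →
      Module.finrank ℂ (Up.map X) + Module.finrank ℂ (Um.map X) ≤ Module.finrank ℂ (LinearMap.range B) ∨
        (26 ≤ Module.finrank ℂ (Up.map X) ∧ 26 ≤ Module.finrank ℂ (Um.map X)) := fun X hX hΘX hXΘ hXc =>
    UnitaryLeviSetup.profile_dichotomy hbr hΘΘ hP hQ hadd hsymm hPQ hdefP hdefQ hadj hmin hB hΘB hBΘ hιι hιΘ hιs hUm hUp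
      hPM hQM hQU hfinQU hrangeP hX hΘX hXΘ hXc
  have hfinQU' := hfinQU
  rw [hr] at hfinQM hfinPU hfinQU hfinPm hfinQm hfinPp hfinQp hsplit hdich
  rw [hQ51] at hfinQM hfinQm hfinUm
  rw [hP28] at hfinPU hfinPp hfinUp
  have hcm : ∀ Z : Module.End ℂ W, Z * ι = ι * Z → ∀ x ∈ Um, Z x ∈ Um := fun Z hZ x hx =>
    (hUm _).2 (by rw [← Module.End.mul_apply, ← hZ, Module.End.mul_apply, (hUm x).1 hx, map_neg])
  have hcp : ∀ Z : Module.End ℂ W, Z * ι = ι * Z → ∀ x ∈ Up, Z x ∈ Up := fun Z hZ x hx =>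
    (hUp _).2 (by rw [← Module.End.mul_apply, ← hZ, Module.End.mul_apply, (hUp x).1 hx])
  have hfullm_of : Lm = ⊤ → False := fun h =>
    UnitaryLeviSetup.false_of_full_larger hbr hΘΘ hno1 hιι hιΘ hUm hUp (by omega) (by omega) hPM hQM (by omega)
      (by omega) hLm h
  have hkillm25 : ∀ X ∈ 𝔊, Θ * X = X → X * Θ = -X → X * ι = ι * X → Module.finrank ℂ (Um.map X) ≠ 25 := by
    intro X hX hΘX hXΘ hXc h25
    obtain ⟨hxmem, hιmx, hxιm, hxrk⟩ := UnitaryLeviSetup.restrict_mem hcm hLm hιmapply X hX hΘX hXΘ hXc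
    rw [h25] at hxrk
    refine hfullm_of (UnitaryDoubleLevi.eq_top_of_raise_of_core' hbrLm hirrLm hιmmem hιmιm hPm hQm
      (s := fun v w : Um => s (v : W) w) (hsU Um) (fun v w => hsymm v w) hPmQm hdefPm hdefQm hadjLm hxmem hιmx hxιm
      (by rw [hxrk]; omega) (by omega) (by omega)
      fun U' 𝔩' ι' P' Q' hbr𝔩' hirr𝔩' hι' hι'ι' hP' hQ' hfinP' hfinQ' hP'Q' hdefP' hdefQ' hadj𝔩' => ?_)
    rw [hxrk] at hfinP' hfinQ'
    exact UnitaryThreeCoprime.eq_top_of_finrank_eq_one hbr𝔩' hirr𝔩' hι' hι'ι' hP' hQ' (by omega) (by omega)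
  have hfullp_of : Lp = ⊤ → False := by
    intro hLptop
    obtain ⟨T1, hιT1, hT1ι, hT1r⟩ := UnitaryRaisingSpace.exists_raise_finrank_range_eq hιpιp hPp hQp (k := 1)
      (by omega) (by omega)
    obtain ⟨X1, hX1, hΘX1, hX1Θ, hX1c, hX1Up⟩ := UnitaryLeviSetup.exists_lift hbr hΘ hΘΘ hcp hιΘ hLp hιpapply T1
      (by rw [hLptop]; exact Submodule.mem_top) hιT1 hT1ι
    rw [hT1r] at hX1Up
    obtain ⟨hs1, hi1, hi1', hj1, hj1'⟩ := hsplit X1 hΘX1 hX1Θ hX1c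
    have hrk1 := hS X1 hX1 hΘX1 hX1Θ
    have hd1 := hdich X1 hX1 hΘX1 hX1Θ hX1c
    rw [hs1] at hrk1
    rw [hX1Up] at hrk1 hd1
    have hk_hkillm25 := hkillm25 X1 hX1 hΘX1 hX1Θ hX1c
    omega
  have hprof0 : ∀ X ∈ 𝔊, Θ * X = X → X * Θ = -X → X * ι = ι * X →
      (Module.finrank ℂ (Up.map X) = 0 ∧ Module.finrank ℂ (Um.map X) = 0) ∨
        (Module.finrank ℂ (Up.map X) = 2 ∧ Module.finrank ℂ (Um.map X) = 24) := by
    intro X hX hΘX hXΘ hXc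
    obtain ⟨hs, hi, hi', hj, hj'⟩ := hsplit X hΘX hXΘ hXc
    have hkillm25' := hkillm25 X hX hΘX hXΘ hXc
    have hrk := hS X hX hΘX hXΘ
    have hd := hdich X hX hΘX hXΘ hXc
    rw [hs] at hrk
    generalize Module.finrank ℂ ↥(Submodule.map X Um) = jj at *
    have hjle : jj ≤ 25 := by omega
    interval_cases jj
    · exact Or.inl ⟨by omega, rfl⟩
    · exfalso; omega
    · exfalso; omega
    · exfalso; omega
    · exfalso; omega
    · exfalso; omega
    · exfalso; omega
    · exfalso; omega
    · exfalso; omega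
    · exfalso; omega
    · exfalso; omega
    · exfalso; omega
    · exfalso; omega
    · exfalso; omega
    · exfalso; omega
    · exfalso; omega
    · exfalso; omega
    · exfalso; omega
    · exfalso; omega
    · exfalso; omega
    · exfalso; omega
    · exfalso; omega
    · exfalso; omega
    · exfalso; omega
    · exact Or.inr (⟨by omega, rfl⟩)
    · exact (hkillm25' rfl).elim
  have hkillmF24 : ∀ X ∈ 𝔊, Θ * X = X → X * Θ = -X → X * ι = ι * X → Module.finrank ℂ (Um.map X) ≠ 24 := by
    intro X hX hΘX hXΘ hXc h24
    obtain ⟨hxmem, hιmx, hxιm, hxrk⟩ := UnitaryLeviSetup.restrict_mem hcm hLm hιmapply X hX hΘX hXΘ hXc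
    rw [h24] at hxrk
    refine UnitaryConstantRank.false_of_le_rank hbrLm hirrLm hιmmem hιmιm hPm hQm (s := fun v w : Um => s (v : W) w)
      (hsU Um) (fun v w => hsymm v w) hPmQm hdefPm hdefQm hadjLm hxmem hιmx hxιm
      (by rw [hxrk]; omega) (by rw [hxrk]; omega) fun A hA hιmA hAιm hAne => ?_
    obtain ⟨X', hX', hΘX', hX'Θ, hX'c, hX'Um⟩ :=
      UnitaryLeviSetup.exists_lift hbr hΘ hΘΘ hcm hιΘ hLm hιmapply A hA hιmA hAιm
    have hA0 : Module.finrank ℂ (LinearMap.range A) ≠ 0 := fun h =>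
      hAne (LinearMap.range_eq_bot.1 (Submodule.finrank_eq_zero.1 h))
    have hp := hprof0 X' hX' hΘX' hX'Θ hX'c
    rw [← hX'Um] at hA0
    rw [hxrk, ← hX'Um]
    omega
  have hprof : ∀ X ∈ 𝔊, Θ * X = X → X * Θ = -X → X * ι = ι * X →
      (Module.finrank ℂ (Up.map X) = 0 ∧ Module.finrank ℂ (Um.map X) = 0) := by
    intro X hX hΘX hXΘ hXc
    have hp := hprof0 X hX hΘX hXΘ hXc
    have hkillmF24' := hkillmF24 X hX hΘX hXΘ hXc
    omega
  obtain ⟨⟨p, hp⟩, hp0⟩ := Module.finrank_pos_iff_exists_ne_zero.1 (show 0 < Module.finrank ℂ PU by omega)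
  obtain ⟨⟨q, hq⟩, hq0⟩ := Module.finrank_pos_iff_exists_ne_zero.1 (show 0 < Module.finrank ℂ QU by omega)
  obtain ⟨X₀, hX₀, hΘX₀, hX₀Θ, hX₀c, c₀, hιc₀, -, hX₀c0⟩ :=
    UnitaryLeviFull.exists_raise_commute_apply_ne_zero hbr hirr hΘ hΘΘ hQ hιmem hιι hιΘ hUm hUp
      ⟨p, fun h => hp0 (Subtype.ext h), ((hPU p).1 hp).1, ((hPU p).1 hp).2⟩
      ⟨q, fun h => hq0 (Subtype.ext h), ((hQU q).1 hq).1, ((hQU q).1 hq).2⟩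
  have hX₀i : Module.finrank ℂ (Up.map X₀) ≠ 0 := fun h0 => by
    have hmem : X₀ c₀ ∈ Up.map X₀ := Submodule.mem_map_of_mem ((hUp c₀).2 hιc₀)
    rw [Submodule.finrank_eq_zero.1 h0, Submodule.mem_bot] at hmem
    exact hX₀c0 hmem
  have hp0 := hprof X₀ hX₀ hΘX₀ hX₀Θ hX₀c
  omega

/-- `(28 | 51)`, minimal rank `27`: `L⁺` of type `(1 | 27)` is full and a lift with `i = 1` has no feasible `j`. [cite: Ribet1983, Thm. 3] [cite: Gordon1997, Thm. 6.3 (3)]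
[cite: Deligne1982HodgeCycles, I §3 Prop. 3.4, 3.6] [cite: GoodmanWallachGTM255, §4.1.1] -/
theorem UnitaryTwentyEightFiftyOne.no_minRank_27 [FiniteDimensional ℂ W] {𝔊 : Submodule ℂ (Module.End ℂ W)}
    (hbr : ∀ Y ∈ 𝔊, ∀ Z ∈ 𝔊, Y * Z - Z * Y ∈ 𝔊)
    (hirr : ∀ U : Submodule ℂ W, (∀ A ∈ 𝔊, ∀ u ∈ U, A u ∈ U) → U = ⊥ ∨ U = ⊤)
    {Θ : Module.End ℂ W} (hΘ : Θ ∈ 𝔊) (hΘΘ : Θ * Θ = 1)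
    {P Q : Submodule ℂ W} (hP : ∀ x, x ∈ P ↔ Θ x = x) (hQ : ∀ x, x ∈ Q ↔ Θ x = -x)
    (hP28 : Module.finrank ℂ P = 28) (hQ51 : Module.finrank ℂ Q = 51)
    {s : W → W → ℂ} (hadd : ∀ x y z, s (x + y) z = s x z + s y z)
    (hsmul : ∀ (c : ℂ) (x y : W), s (c • x) y = c * s x y) (hsymm : ∀ x y, s y x = starRingEnd ℂ (s x y))
    (hPQ : ∀ p ∈ P, ∀ q ∈ Q, s p q = 0) (hdefP : ∀ p ∈ P, s p p = 0 → p = 0) (hdefQ : ∀ q ∈ Q, s q q = 0 → q = 0)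
    (hadj : ∀ X ∈ 𝔊, ∃ Y ∈ 𝔊, ∀ x y, s (X x) y = s x (Y y))
    (hS : ∀ B' ∈ 𝔊, Θ * B' = B' → B' * Θ = -B' →
      Module.finrank ℂ (LinearMap.range B') = 0 ∨ Module.finrank ℂ (LinearMap.range B') = 27 ∨ Module.finrank ℂ (LinearMap.range B') = 28)
    {B : Module.End ℂ W} (hB : B ∈ 𝔊) (hΘB : Θ * B = B) (hBΘ : B * Θ = -B)
    (hr : Module.finrank ℂ (LinearMap.range B) = 27) : False := by
  classical
  have hsU : ∀ U : Submodule ℂ W, ∀ x y z : U, s ((x + y : U) : W) z = s (x : W) z + s (y : W) z :=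
    fun U x y z => by simp only [Submodule.coe_add, hadd]
  have hsmU : ∀ U : Submodule ℂ W, ∀ (c : ℂ) (x y : U), s ((c • x : U) : W) y = c * s (x : W) y :=
    fun U c x y => by simp only [Submodule.coe_smul, hsmul]
  have hno1 : ∀ B' ∈ 𝔊, Θ * B' = B' → B' * Θ = -B' → Module.finrank ℂ (LinearMap.range B') ≠ 1 := by
    intro B' hB' hΘB' hB'Θ h1
    rcases hS B' hB' hΘB' hB'Θ with h | h | h <;> omega
  have hmin : ∀ Y ∈ 𝔊, Θ * Y = Y → Y * Θ = -Y → Y ≠ 0 → 27 ≤ Module.finrank ℂ (LinearMap.range Y) := by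
    intro Y hY hΘY hYΘ hY0
    have h0 : Module.finrank ℂ (LinearMap.range Y) ≠ 0 := fun h =>
      hY0 (LinearMap.range_eq_bot.1 (Submodule.finrank_eq_zero.1 h))
    rcases hS Y hY hΘY hYΘ with h | h | h <;> omega
  have hmin' : ∀ Z ∈ 𝔊, Θ * Z = Z → Z * Θ = -Z → Z ≠ 0 → Module.finrank ℂ (LinearMap.range B) ≤ Module.finrank ℂ (LinearMap.range Z) := by
    rw [hr]; exact hmin
  obtain ⟨ι, Um, Up, PU, QU, Lm, ιm, Pm, Qm, Lp, ιp, Pp, Qp, hιmem, hιι, hιΘ, hιs, hUm, hUp, hfinUm, hfinUp,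
    hPM, hQM, hPU, hQU, hrangeP, hPUP, hQUQ, hfinQM, hfinPU, hfinQU, hLm, hLp,
    hιmapply, hPmmem, hQmmem, hbrLm, hirrLm, hιmmem, hιmιm, hPm, hQm, hfinPm, hfinQm, hPmQm, hdefPm, hdefQm, hadjLm,
    hιpapply, hPpmem, hQpmem, hbrLp, hirrLp, hιpmem, hιpιp, hPp, hQp, hfinPp, hfinQp, hPpQp, hdefPp, hdefQp, hadjLp,
    hsplit⟩ :=
    UnitaryLeviSetup.exists_levi_pair hbr hirr hΘ hΘΘ hP hQ hadd hsymm hPQ hdefP hdefQ hadj hB hΘB hBΘ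
  have hdich : ∀ X ∈ 𝔊, Θ * X = X → X * Θ = -X → X * ι = ι * X →
      Module.finrank ℂ (Up.map X) + Module.finrank ℂ (Um.map X) ≤ Module.finrank ℂ (LinearMap.range B) ∨
        (27 ≤ Module.finrank ℂ (Up.map X) ∧ 27 ≤ Module.finrank ℂ (Um.map X)) := fun X hX hΘX hXΘ hXc =>
    UnitaryLeviSetup.profile_dichotomy hbr hΘΘ hP hQ hadd hsymm hPQ hdefP hdefQ hadj hmin hB hΘB hBΘ hιι hιΘ hιs hUm hUp
      hPM hQM hQU hfinQU hrangeP hX hΘX hXΘ hXc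
  have hfinQU' := hfinQU
  rw [hr] at hfinQM hfinPU hfinQU hfinPm hfinQm hfinPp hfinQp hsplit hdich
  rw [hQ51] at hfinQM hfinQm hfinUm
  rw [hP28] at hfinPU hfinPp hfinUp
  have hcm : ∀ Z : Module.End ℂ W, Z * ι = ι * Z → ∀ x ∈ Um, Z x ∈ Um := fun Z hZ x hx =>
    (hUm _).2 (by rw [← Module.End.mul_apply, ← hZ, Module.End.mul_apply, (hUm x).1 hx, map_neg])
  have hcp : ∀ Z : Module.End ℂ W, Z * ι = ι * Z → ∀ x ∈ Up, Z x ∈ Up := fun Z hZ x hx =>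
    (hUp _).2 (by rw [← Module.End.mul_apply, ← hZ, Module.End.mul_apply, (hUp x).1 hx])
  have hfullm_of : Lm = ⊤ → False := fun h =>
    UnitaryLeviSetup.false_of_full_larger hbr hΘΘ hno1 hιι hιΘ hUm hUp (by omega) (by omega) hPM hQM (by omega)
      (by omega) hLm h
  have hLptop : Lp = ⊤ :=
    UnitaryThreeCoprime.eq_top_of_finrank_eq_one hbrLp hirrLp (Submodule.neg_mem _ hιpmem) ((neg_mul_neg ιp ιp).trans hιpιp) (P := Qp) (Q := Pp) (fun x => by rw [hQp, LinearMap.neg_apply, neg_eq_iff_eq_neg]) (fun x => by rw [hPp, LinearMap.neg_apply, neg_inj]) (by omega) (by omega)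
  obtain ⟨T1, hιT1, hT1ι, hT1r⟩ := UnitaryRaisingSpace.exists_raise_finrank_range_eq hιpιp hPp hQp (k := 1)
    (by omega) (by omega)
  obtain ⟨X1, hX1, hΘX1, hX1Θ, hX1c, hX1Up⟩ := UnitaryLeviSetup.exists_lift hbr hΘ hΘΘ hcp hιΘ hLp hιpapply T1
    (by rw [hLptop]; exact Submodule.mem_top) hιT1 hT1ι
  rw [hT1r] at hX1Up
  obtain ⟨hs1, hi1, hi1', hj1, hj1'⟩ := hsplit X1 hΘX1 hX1Θ hX1c
  have hrk1 := hS X1 hX1 hΘX1 hX1Θ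
  have hd1 := hdich X1 hX1 hΘX1 hX1Θ hX1c
  rw [hs1] at hrk1
  rw [hX1Up] at hrk1 hd1
  omega


end HodgeStructure

end Literature.AlgebraicGeometry.Motives

end
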